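import Literature.MathematicalPhysics.QuantumFieldTheory.Balaban1983to89.B9B8KnitLetterMajorantTransfer
import Literature.MathematicalPhysics.QuantumFieldTheory.Balaban1983to89.B9Thm314GpFlatResolvent

/-!
# `Balaban1983to89.B9B8KnitLetterE12Sup` — FROM A (3.42) BLOCK MAJORANT AT THE KNIT LETTER TO THE CONSUMER's (E12) LINES: on a constant-level-`n`
# member, `‖(G′(U; parKnitY)Λ)(z)‖ ≤ (Σ‖b_j‖)·A·c·M₂·L^{2n}·sup‖Λ‖`, `‖(∇_{U,μ}G′(U; parKnitY)Λ)(z)‖ ≤ (Σ‖b_j‖)·A₁·c·M₂·Lⁿ·sup‖Λ‖`, hence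
# `‖(η²G′Λ)(z)‖, (Lʲη)·η⁻¹‖(∇_μ η²G′Λ)(z)‖ ≤ B_G·r` whenever `(Lⁿη)²‖Λ‖ ≤ r` — [B8] (1.101) for `G′` at print's own transporters, modulo the
# displayed majorants (junction J-B file 11)

statement-level skeleton of published theorems with citation tags; proofs where landed; nothing here is a claim about the
Yang–Mills mass gap

T. Bałaban, *Propagators for lattice gauge theories in a background field*, Commun. Math. Phys. **99** (1985) 389–434 [`Balaban1985BackgroundPropagators`,
"[B9]"]; T. Bałaban, *Propagators and renormalization transformations for lattice gauge theories. II*, Commun. Math. Phys. **96** (1984) 223–250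
[`Balaban1984PropagatorsII`, "[4]"]; T. Bałaban, *Spaces of regular gauge field configurations on a lattice and gauge fixing conditions*, Commun. Math.
Phys. **99** (1985) 75–102 [`Balaban1985RegularSpaces`, "[B8]"].

THE PRINT.  [B8] (1.101) p. 93: *«|G′f|, |∇_{U₀}G′f|₍₁₎ ≦ B_G|f|₍₋₂₎»* with `|f|₍₋₂₎ = sup_j sup_{Ω_j}(Lʲη)²|f|` (p. 86) — read by the consumer as the letter law
(E12) `gp_sup_grad` of `B8Thm2TorusLetters.LettersAt(Per)` (`Bd2 … f r → ‖Gp n f x‖ ≤ BG·r ∧ (Lʲη)‖D_μ(Gp n f)(x)‖ ≤ BG·r`, `j ≤ n`), at `Ω_j = T_η` (p. 77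
«we admit the case where some domains Ω_j are equal to T_η»: the constant-level member).  [B9] p. 398: *«the global inequalities (3.47) are consequences
of the local ones (3.42) and Lemma 2.1»* — with [4] (2.52) p. 232 (`λ = Σ_{y′}Δ(y′)λ`) and (2.61) p. 234 (the row sum) this is the present file's §1.

WHY THIS FILE ∕ THE ARGUMENT.  Junction files 9–10 deliver, at print's transporters `parKnitY`, the (3.42)₁ ∕ (3.42)₂ BLOCK MAJORANTS of
`conj b(η²G′(U))` and of `conj b(η⁻¹∇_μ)·conj b(η²G′(U))` (`η = etaS i = L^{−k}`) in the `HasMajorant` currency of [4] (2.51).  The consumer's (E12) is a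
SUP-norm law on the torus member: §1 decomposes an arbitrary argument into its block pieces ([4] (2.52), `B9Thm314GpFlatResolvent.abs_le_sum_of_hasMajorant`),
reads the real coordinates back into the norm of `M_N(ℂ)` (`norm_le_basisBound_mul`, constants `M₂`, `Σ‖b_j‖`), and sums the kernel with the row bound `c`
of (2.61); §2 evaluates the block scale on a constant-level-`n` member (`ℓ(y) = Lⁿ∕|c_f| = Lⁿη` in print's units `c_f = L^k`); §3 rescales to the consumer's
`η`-units (`GpKnitY η U = η²·G′`, junction file 3; `D^η_μ = η⁻¹∇_μ`, J-A `covDerivFwd_liftY`): the factor `(Lⁿη)²` of the sup bound is exactly the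
`|·|₍₋₂₎`-weight at level `n`, so `B_G = (Σ‖b_j‖)·A·c·M₂` is free of the member, the volume, `n`, `k`, `N` and `η`.

CITATION HEADER (lean-in-tree rule).  Cell `lit-balaban`, sub-row G-B9-LETTERS, junction J-B (lead RULINGS #3–#4; RULING #4 (ii) «(E12)-type bounds from
Thm 3.1 at the knit letter») file 11 → seat `lit-balaban-p33` gen 94.  REUSED BY NAME: r03∕p21-lineage `B6RandomWalk.HasMajorant`,
`B9Thm314GpFlatResolvent.abs_le_sum_of_hasMajorant`; n06-j's `B9CoReadingCoords.norm_le_basisBound_mul`, `B9Eq352DivFormLetters.conj_apply ∕ coordEquiv`,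
`B9Eq352GradLetters.diffLetter`, `Node00.OpsYRead342.gradF_mul_apply` (the second (3.42) member's operator); `B6Ineq2142KLevelV1.beta_level`; junction files 1 ∕ 3
(`covDerivFwd_liftY`, `GpKnitY`).  The displayed majorants `hG` ∕ `hD` are the OUTPUT SHAPES of junction files 9 ∕ 10 (`…_len`).

WHAT THIS FILE PROVES (sorry-free; no definitions; the block majorants are DISPLAYED HYPOTHESES, nothing of [B9] ∕ [B8] asserted).
* §1 (any `ℝ`-linear `T` on `SiteY i → 𝔸`, any block majorant) `norm_apply_le_of_hasMajorant_sup` (`‖(TΛ)(z)‖ ≤ (Σ‖b_j‖)·(Σ_{y′}K(y(z),y′))·M₂·M` for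
  `‖Λ‖ ≤ M`), `norm_apply_le_of_hasMajorant_exp` (kernel `C·P(y)·e^{−δd}` + row sum `≤ c`: `≤ (Σ‖b_j‖)·C·P(y(z))·c·M₂·M`).
* §2 `lvl_ιB_blkOf`, `geo9K_len_ιB_blkOf` (`ℓ(ιB(Δ(z))) = L^{j(z)}∕|c_f|`), `geo9K_len_sq_constLev` (`= (Lⁿ)²·η²` at `c_f = L^k` on a level-`n` member).
* §3 at the knit letter (`𝔸 = M_N(ℂ)`), level-`n` member, `c_f = L^k`: ★★ `norm_GpY_parKnitY_apply_le` (`‖(G′Λ)(z)‖ ≤ (Σ‖b_j‖)·A·c·M₂·(Lⁿ)²·M`), ★★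
  `norm_cdS_GpY_parKnitY_apply_le` (`‖(∇_{U,μ}G′Λ)(z)‖ ≤ (Σ‖b_j‖)·A₁·c·M₂·Lⁿ·M`), and the consumer's lines under `(Lⁿη)²‖Λ(w)‖ ≤ r` (`η ≠ 0`): ★★★
  **`norm_GpKnitY_apply_le`** (`‖(GpKnitY η U Λ)(z)‖ ≤ (Σ‖b_j‖)·A·c·M₂·r`), ★★★ **`wt_norm_cdS_GpKnitY_apply_le`** (`(Lʲη)·η⁻¹·‖(∇_{U,μ}(GpKnitY η U Λ))(z)‖ ≤
  (Σ‖b_j‖)·A₁·c·M₂·r` for `j ≤ n`), ★ `wt_norm_covDerivFwd_liftFun_le` (the same read on the knit's `ℤ^{d+1}` carrier through J-A's `covDerivFwd_liftY`).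

HONEST SCOPE.  Bookkeeping from displayed block majorants (suppliers: junction files 9–10, fed by M5.5 at def-Y's letter) to sup-norm lines; the row-sum
bound `c` is a hypothesis of (2.61)'s shape (supplier: `B9Thm37GpTorusRegular.geo_inputs_geo9K` at the rate in hand); `B_G` explicit.  NOT the letter
structure itself (its assembly over truncations, periodic arguments and the remaining laws is the sub-row's M5.9).  Count-neutral; nothing continuum, nothing
about OS axioms or the mass gap.  No `sorry`, no `axiom`, no `instance`, no `notation`.  NEW file; nothing landed is modified.  Net new unproved facts: 0.
Seat `lit-balaban-p33` gen 94, 2026-08-28.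
-/

noncomputable section

namespace Literature.MathematicalPhysics.QuantumFieldTheory.Balaban1983to89.B9B8KnitLetterE12Sup

open Node00 B6KLevelCensusIndexV1 B6Geom246MultiLevelBox B9BackgroundsKLevelV1 B9Eq39Adjoint B9Thm311ReadingCoords B9Thm311DeltaPrimePos
open B6RandomWalk (HasMajorant)
open B9Thm34Ext (toB6 toB6_dist)
open B9GeoNormsKLevelV1 (geo9K geo9K_len_kGeo)
open B9Eq352DivFormLetters (coordEquiv coordEquiv_apply conj conj_apply)
open B9Eq352GradLetters (diffLetter diffLetter_inl)
open B9CoReadingCoords (norm_le_basisBound_mul)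
open B9Thm314GpFlatResolvent (abs_le_sum_of_hasMajorant)
open B9Ineq349SiteComposite (etaS_pos)
open B6Prop22KLevelTorusCensusEta (nKT)
open B6Ineq2142KLevelV1 (β lvl beta_level)
open Node00.OpsYRead342 (gradF_mul_apply)
open B9B8CarrierDictionary (liftCfg liftFun liftFun_apply covDerivFwd_liftY)
open B9B8AveragingJunction (parKnitY levY_of_blkOf)
open B9Thm311PositivityKnitLetter (GpKnitY GpKnitY_apply)
open B8Ineq132 (covDerivFwd)
open B10Eq27TorusAxialLog (transl)
open B6GlobalChartV1 (boxEquiv)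
open scoped Matrix Matrix.Norms.L2Operator

variable {d ℓ : ℕ} {hd : 1 ≤ d + 1} {hL : Odd (ℓ + 1) ∧ 1 < ℓ + 1} {b₀ b₁ : ℝ}
variable (i : KIdx d ℓ hd hL b₀ b₁)

/-! ## §1 From a block majorant of `conj b T` to a sup-norm bound of `T` ([4] (2.52) + (2.51) + (2.61)) -/

section Generic

variable {𝔸 : Type} [NormedRing 𝔸] [NormedAlgebra ℂ 𝔸] [CompleteSpace 𝔸]
variable {ι : Type} [Fintype ι] (b : Module.Basis ι ℝ 𝔸)
variable [Fintype (geo9K i).Site] {Rr : ℝ} {Hp : Prop} (ιB : BlkY i → IBondY i)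

omit [CompleteSpace 𝔸] in
/-- ★ **[4] (2.52) + (2.51) READ BACK INTO `𝔸`**: a block majorant `K` of `conj b T` w.r.t. `(z, j) ↦ ιB(Δ(z))` and a real basis with `|b.repr v j| ≤ M₂‖v‖`
bound `T` in sup norm: `‖(TΛ)(z)‖ ≤ (Σ_j‖b_j‖)·(Σ_{y′}K(ιB(Δ(z)), y′))·M₂·M` whenever `‖Λ(w)‖ ≤ M` for all `w`.
[cite: Balaban1984PropagatorsII, (2.51)–(2.52) p.232; Balaban1985BackgroundPropagators, p.398 («(3.47) … consequences of (3.42) and Lemma 2.1»)] -/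
theorem norm_apply_le_of_hasMajorant_sup (T : Module.End ℝ (SiteY i → 𝔸)) {K : (geo9K i).Site → (geo9K i).Site → ℝ}
    (hT : HasMajorant (g := toB6 (geo9K i) Rr Hp) (fun p : SiteY i × ι => ιB (blkOf i.D.toDomains p.1)) (conj b T) K)
    {M₂ : ℝ} (hM₂ : 0 ≤ M₂) (hrepr : ∀ (v : 𝔸) (j : ι), |b.repr v j| ≤ M₂ * ‖v‖)
    (Λ : SiteY i → 𝔸) {M : ℝ} (hΛ : ∀ w, ‖Λ w‖ ≤ M) (z : SiteY i) :
    ‖T Λ z‖ ≤ (∑ j, ‖b j‖) * ((∑ a' : (geo9K i).Site, K (ιB (blkOf i.D.toDomains z)) a') * (M₂ * M)) := by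
  have hM : 0 ≤ M := (norm_nonneg _).trans (hΛ z)
  have hμ : ∀ p : SiteY i × ι, |coordEquiv b Λ p| ≤ (fun _ : (geo9K i).Site => M₂ * M) (ιB (blkOf i.D.toDomains p.1)) := fun p => by
    rw [coordEquiv_apply]
    exact (hrepr _ _).trans (mul_le_mul_of_nonneg_left (hΛ p.1) hM₂)
  have hco : ∀ j : ι, |b.repr (T Λ z) j| ≤ (∑ a' : (geo9K i).Site, K (ιB (blkOf i.D.toDomains z)) a') * (M₂ * M) := by
    intro j
    have h := abs_le_sum_of_hasMajorant (g := toB6 (geo9K i) Rr Hp) (fun p : SiteY i × ι => ιB (blkOf i.D.toDomains p.1)) hT (coordEquiv b Λ)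
      (fun _ => M₂ * M) (fun _ => mul_nonneg hM₂ hM) hμ (z, j)
    rw [conj_apply, LinearEquiv.symm_apply_apply, ← Finset.sum_mul] at h
    exact h
  exact norm_le_basisBound_mul b _ hco

omit [CompleteSpace 𝔸] in
/-- ★ **… WITH AN EXPONENTIAL KERNEL AND THE ROW SUM (2.61)**: for the majorant `C·P(y)·e^{−δd(y,y′)}` (`C, P ≥ 0`) and `Σ_{y′}e^{−δd(y,y′)} ≤ c` for every `y`:
`‖(TΛ)(z)‖ ≤ (Σ_j‖b_j‖)·C·P(ιB(Δ(z)))·c·M₂·M`. [cite: Balaban1984PropagatorsII, (2.51)–(2.52) p.232, Lemma 2.1 (2.61) p.234; Balaban1985BackgroundPropagators, (3.47) p.398] -/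
theorem norm_apply_le_of_hasMajorant_exp (T : Module.End ℝ (SiteY i → 𝔸)) {C δ c : ℝ} {P : (geo9K i).Site → ℝ} (hC : 0 ≤ C) (hP : ∀ a, 0 ≤ P a)
    (hT : HasMajorant (g := toB6 (geo9K i) Rr Hp) (fun p : SiteY i × ι => ιB (blkOf i.D.toDomains p.1)) (conj b T)
      (fun a a' => C * P a * Real.exp (-(δ * (geo9K i).dist a a'))))
    (hrow : ∀ a : (geo9K i).Site, ∑ a' : (geo9K i).Site, Real.exp (-(δ * (geo9K i).dist a a')) ≤ c)
    {M₂ : ℝ} (hM₂ : 0 ≤ M₂) (hrepr : ∀ (v : 𝔸) (j : ι), |b.repr v j| ≤ M₂ * ‖v‖)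
    (Λ : SiteY i → 𝔸) {M : ℝ} (hΛ : ∀ w, ‖Λ w‖ ≤ M) (z : SiteY i) :
    ‖T Λ z‖ ≤ (∑ j, ‖b j‖) * (C * P (ιB (blkOf i.D.toDomains z)) * c * (M₂ * M)) := by
  have hM : 0 ≤ M := (norm_nonneg _).trans (hΛ z)
  have hSb : 0 ≤ ∑ j, ‖b j‖ := Finset.sum_nonneg fun _ _ => norm_nonneg _
  refine (norm_apply_le_of_hasMajorant_sup i b ιB T hT hM₂ hrepr Λ hΛ z).trans (mul_le_mul_of_nonneg_left ?_ hSb)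
  refine mul_le_mul_of_nonneg_right ?_ (mul_nonneg hM₂ hM)
  rw [← Finset.mul_sum]
  exact mul_le_mul_of_nonneg_left (hrow _) (mul_nonneg hC (hP _))

end Generic

/-! ## §2 The block scale on a constant-level member -/

section Scale

variable (ιB : BlkY i → IBondY i)

/-- the level of the index bond `ιB(Δ(z))` is the level of `z` (`ιB` a section of `β`). [cite: Balaban1984PropagatorsII, (2.3)–(2.4) p.224, (2.45) p.231, dictionary] -/
theorem lvl_ιB_blkOf (hι : ∀ s, β i.hN i.D i.hk (ιB s) = s) (z : SiteY i) : lvl i.hN i.D i.hk (ιB (blkOf i.D.toDomains z)) = levY i z := by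
  have hk1 : 1 ≤ i.k := le_trans (by norm_num) i.hk2
  rw [← beta_level i.hN i.D i.hk hk1, hι, levY_of_blkOf i rfl]

/-- the block scale of the member's geometry at `ιB(Δ(z))`: `ℓ = L^{j(z)}∕|c_f|`. [cite: Balaban1984PropagatorsII, (2.1) p.224; Balaban1985BackgroundPropagators, (3.41) p.397 («Lʲη»)] -/
theorem geo9K_len_ιB_blkOf (hι : ∀ s, β i.hN i.D i.hk (ιB s) = s) (z : SiteY i) :
    (geo9K i).len (ιB (blkOf i.D.toDomains z)) = (((ℓ + 1 : ℕ) : ℝ)) ^ (levY i z) / |i.cf| := by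
  rw [geo9K_len_kGeo, len_eq i, lvl_ιB_blkOf i ιB hι z]

/-- ★ on a CONSTANT-LEVEL-`n` member in print's units `c_f = L^k`: `ℓ(ιB(Δ(z)))² = (Lⁿ)²·η²` with `η = etaS i = L^{−k}`.
[cite: Balaban1984PropagatorsII, (2.1) p.224 («η = L^{−k}»); Balaban1985RegularSpaces, p.77 («Ω_j = T_η»)] -/
theorem geo9K_len_sq_constLev (hι : ∀ s, β i.hN i.D i.hk (ιB s) = s) {n : ℕ} (hlev : ∀ z : SiteY i, levY i z = n)
    (hcf : i.cf = (((ℓ + 1 : ℕ) : ℝ)) ^ i.k) (z : SiteY i) :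
    (geo9K i).len (ιB (blkOf i.D.toDomains z)) ^ 2 = ((((ℓ + 1 : ℕ) : ℝ)) ^ n) ^ 2 * etaS i ^ 2 := by
  have hk : nKT (toKT i) = (ℓ + 1) ^ i.k := rfl
  have hpos : (0 : ℝ) < (((ℓ + 1 : ℕ) : ℝ)) ^ i.k := by positivity
  rw [geo9K_len_ιB_blkOf i ιB hι, hlev z, hcf, abs_of_pos hpos]
  unfold etaS
  rw [hk]; push_cast; ring

end Scale

/-! ## §3 At the knit letter: the two (E12) lines -/

section Knit

variable {N : ℕ} {ι : Type} [Fintype ι] (b : Module.Basis ι ℝ (Matrix (Fin N) (Fin N) ℂ))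
variable [Fintype (geo9K i).Site] {Rr : ℝ} {Hp : Prop} (ιB : BlkY i → IBondY i)

/-- ★★ **THE SUP BOUND OF `G′(U; parKnitY)` ON A LEVEL-`n` MEMBER** (`c_f = L^k`): from the displayed (3.42)₁ majorant `A·ℓ(y)²·e^{−δd}` of
`conj b(η²G′(U; parKnitY))` (`η = etaS i`; junction file 9's output) and the row sum `≤ c`:  `‖(G′(U; parKnitY)Λ)(z)‖ ≤ (Σ‖b_j‖)·A·c·M₂·(Lⁿ)²·M` whenever
`‖Λ(w)‖ ≤ M`. [cite: Balaban1985BackgroundPropagators, Thm 3.1 (3.42) p.397, (3.47) p.398, (3.19) p.393; Balaban1984PropagatorsII, (2.51)–(2.52) p.232, (2.61) p.234] -/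
theorem norm_GpY_parKnitY_apply_le (hι : ∀ s, β i.hN i.D i.hk (ιB s) = s) {n : ℕ} (hlev : ∀ z : SiteY i, levY i z = n)
    (hcf : i.cf = (((ℓ + 1 : ℕ) : ℝ)) ^ i.k) (U : CfgY (Matrix (Fin N) (Fin N) ℂ) i) {A δ c : ℝ} (hA : 0 ≤ A)
    (hG : HasMajorant (g := toB6 (geo9K i) Rr Hp) (fun p : SiteY i × ι => ιB (blkOf i.D.toDomains p.1))
      (conj b ((etaS i ^ 2) • (GpY i (parKnitY i) U).restrictScalars ℝ))
      (fun a a' => A * (geo9K i).len a ^ 2 * Real.exp (-(δ * (geo9K i).dist a a'))))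
    (hrow : ∀ a : (geo9K i).Site, ∑ a' : (geo9K i).Site, Real.exp (-(δ * (geo9K i).dist a a')) ≤ c)
    {M₂ : ℝ} (hM₂ : 0 ≤ M₂) (hrepr : ∀ (v : Matrix (Fin N) (Fin N) ℂ) (j : ι), |b.repr v j| ≤ M₂ * ‖v‖)
    (Λ : SiteY i → Matrix (Fin N) (Fin N) ℂ) {M : ℝ} (hΛ : ∀ w, ‖Λ w‖ ≤ M) (z : SiteY i) :
    ‖GpY i (parKnitY i) U Λ z‖ ≤ (∑ j, ‖b j‖) * A * c * M₂ * ((((ℓ + 1 : ℕ) : ℝ)) ^ n) ^ 2 * M := by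
  have h := norm_apply_le_of_hasMajorant_exp i b ιB _ hA (fun a => sq_nonneg _) hG hrow hM₂ hrepr Λ hΛ z
  have hη : 0 < etaS i := etaS_pos i
  have hη2 : 0 < etaS i ^ 2 := pow_pos hη 2
  rw [geo9K_len_sq_constLev i ιB hι hlev hcf z, LinearMap.smul_apply, Pi.smul_apply, LinearMap.restrictScalars_apply, ← Complex.coe_smul, norm_smul,
    Complex.norm_real, Real.norm_of_nonneg hη2.le] at h
  refine le_of_mul_le_mul_left (h.trans (le_of_eq ?_)) hη2
  ring

/-- ★★ **THE SUP BOUND OF `∇_{U,μ}G′(U; parKnitY)` ON A LEVEL-`n` MEMBER** (`c_f = L^k`): from the displayed (3.42)₂ majorant `A₁·ℓ(y)·e^{−δd}` of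
`conj b(η⁻¹∇_μ-letter)·conj b(η²G′(U; parKnitY))` (junction file 10's output with n06-j's left factor `diffLetter (shiftY i) (UboxY i U) η⁻¹ (inl μ)`) and the
row sum `≤ c`:  `‖(∇_{U,μ}G′(U; parKnitY)Λ)(z)‖ ≤ (Σ‖b_j‖)·A₁·c·M₂·Lⁿ·M` whenever `‖Λ(w)‖ ≤ M`.
[cite: Balaban1985BackgroundPropagators, Thm 3.1 (3.42) p.397, (3.3) p.390, (3.47) p.398; Balaban1984PropagatorsII, (2.51)–(2.52) p.232, (2.61) p.234] -/
theorem norm_cdS_GpY_parKnitY_apply_le (hι : ∀ s, β i.hN i.D i.hk (ιB s) = s) {n : ℕ} (hlev : ∀ z : SiteY i, levY i z = n)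
    (hcf : i.cf = (((ℓ + 1 : ℕ) : ℝ)) ^ i.k) (U : CfgY (Matrix (Fin N) (Fin N) ℂ) i) (μ : Fin (d + 1)) {A₁ δ c : ℝ} (hA₁ : 0 ≤ A₁)
    (hD : HasMajorant (g := toB6 (geo9K i) Rr Hp) (fun p : SiteY i × ι => ιB (blkOf i.D.toDomains p.1))
      (conj b (diffLetter (shiftY i) (UboxY i U) ((((etaS i : ℝ) : ℂ))⁻¹) (Sum.inl μ)) * conj b ((etaS i ^ 2) • (GpY i (parKnitY i) U).restrictScalars ℝ))
      (fun a a' => A₁ * (geo9K i).len a * Real.exp (-(δ * (geo9K i).dist a a'))))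
    (hrow : ∀ a : (geo9K i).Site, ∑ a' : (geo9K i).Site, Real.exp (-(δ * (geo9K i).dist a a')) ≤ c)
    {M₂ : ℝ} (hM₂ : 0 ≤ M₂) (hrepr : ∀ (v : Matrix (Fin N) (Fin N) ℂ) (j : ι), |b.repr v j| ≤ M₂ * ‖v‖)
    (Λ : SiteY i → Matrix (Fin N) (Fin N) ℂ) {M : ℝ} (hΛ : ∀ w, ‖Λ w‖ ≤ M) (z : SiteY i) :
    ‖cdS i U μ (GpY i (parKnitY i) U Λ) z‖ ≤ (∑ j, ‖b j‖) * A₁ * c * M₂ * (((ℓ + 1 : ℕ) : ℝ)) ^ n * M := by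
  have hη : 0 < etaS i := etaS_pos i
  have hpos : (0 : ℝ) < (((ℓ + 1 : ℕ) : ℝ)) ^ i.k := by positivity
  have hlen : ∀ a : (geo9K i).Site, 0 ≤ (geo9K i).len a := fun a => by rw [geo9K_len_kGeo]; exact (len_pos i a).le
  rw [← B9Eq352DivFormLetters.conj_mul, diffLetter_inl] at hD
  have h := norm_apply_le_of_hasMajorant_exp i b ιB _ hA₁ hlen hD hrow hM₂ hrepr Λ hΛ z
  have hGdef : ∀ Λ', ((etaS i ^ 2) • (GpY i (parKnitY i) U).restrictScalars ℝ) Λ' = (etaS i ^ 2) • GpY i (parKnitY i) U Λ' := fun _ => rfl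
  rw [gradF_mul_apply i (GpY i (parKnitY i)) U _ hGdef μ Λ z, norm_smul, Complex.norm_real, Real.norm_of_nonneg hη.le,
    geo9K_len_ιB_blkOf i ιB hι, hlev z, hcf, abs_of_pos hpos] at h
  -- `Lⁿ∕L^k = Lⁿ·η`
  have hk : nKT (toKT i) = (ℓ + 1) ^ i.k := rfl
  have hq : (((ℓ + 1 : ℕ) : ℝ)) ^ n / (((ℓ + 1 : ℕ) : ℝ)) ^ i.k = (((ℓ + 1 : ℕ) : ℝ)) ^ n * etaS i := by
    unfold etaS; rw [hk, div_eq_mul_inv]; push_cast; ring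
  rw [hq] at h
  refine le_of_mul_le_mul_left (h.trans (le_of_eq ?_)) hη
  ring

/-- ★★★ **THE CONSUMER's (E12) SUP LINE AT THE KNIT LETTER** ([B8] (1.101) `|G′f| ≦ B_G|f|₍₋₂₎` on the level-`n` member): with the displayed majorant and row sum as
above, `η ≠ 0` and the level-`n` weight bound `(Lⁿη)²·‖Λ(w)‖ ≤ r` for all `w`:  `‖(GpKnitY η U Λ)(z)‖ ≤ (Σ‖b_j‖)·A·c·M₂·r` — `B_G` free of the member, the
volume, `n`, `k`, `N`, `η`. [cite: Balaban1985RegularSpaces, (1.101) p.93, p.86 (|·|₍₋₂₎), p.77 («Ω_j = T_η»); Balaban1985BackgroundPropagators, Thm 3.1 (3.42) p.397, (3.47) p.398] -/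
theorem norm_GpKnitY_apply_le (hι : ∀ s, β i.hN i.D i.hk (ιB s) = s) {n : ℕ} (hlev : ∀ z : SiteY i, levY i z = n)
    (hcf : i.cf = (((ℓ + 1 : ℕ) : ℝ)) ^ i.k) (U : CfgY (Matrix (Fin N) (Fin N) ℂ) i) {A δ c : ℝ} (hA : 0 ≤ A)
    (hG : HasMajorant (g := toB6 (geo9K i) Rr Hp) (fun p : SiteY i × ι => ιB (blkOf i.D.toDomains p.1))
      (conj b ((etaS i ^ 2) • (GpY i (parKnitY i) U).restrictScalars ℝ))
      (fun a a' => A * (geo9K i).len a ^ 2 * Real.exp (-(δ * (geo9K i).dist a a'))))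
    (hrow : ∀ a : (geo9K i).Site, ∑ a' : (geo9K i).Site, Real.exp (-(δ * (geo9K i).dist a a')) ≤ c)
    {M₂ : ℝ} (hM₂ : 0 ≤ M₂) (hrepr : ∀ (v : Matrix (Fin N) (Fin N) ℂ) (j : ι), |b.repr v j| ≤ M₂ * ‖v‖)
    {η : ℝ} (hη : η ≠ 0) (Λ : SiteY i → Matrix (Fin N) (Fin N) ℂ) {r : ℝ} (hΛ : ∀ w, ((((ℓ + 1 : ℕ) : ℝ)) ^ n * η) ^ 2 * ‖Λ w‖ ≤ r) (z : SiteY i) :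
    ‖GpKnitY i η U Λ z‖ ≤ (∑ j, ‖b j‖) * A * c * M₂ * r := by
  have hw : 0 < ((((ℓ + 1 : ℕ) : ℝ)) ^ n * η) ^ 2 := by positivity
  have hΛ' : ∀ w, ‖Λ w‖ ≤ r / ((((ℓ + 1 : ℕ) : ℝ)) ^ n * η) ^ 2 := fun w => by rw [le_div_iff₀ hw, mul_comm]; exact hΛ w
  have h := norm_GpY_parKnitY_apply_le i b ιB hι hlev hcf U hA hG hrow hM₂ hrepr Λ hΛ' z
  rw [GpKnitY_apply, Pi.smul_apply, norm_smul, Complex.norm_real, Real.norm_of_nonneg (mul_self_nonneg η)]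
  have hη2 : 0 ≤ η * η := mul_self_nonneg η
  refine (mul_le_mul_of_nonneg_left h hη2).trans (le_of_eq ?_)
  field_simp

/-- ★★★ **THE CONSUMER's (E12) GRADIENT LINE AT THE KNIT LETTER** ([B8] (1.101) `|∇_{U₀}G′f|₍₁₎ ≦ B_G|f|₍₋₂₎` on the level-`n` member): with the displayed
(3.42)₂ majorant and row sum, `η ≠ 0`, `(Lⁿη)²‖Λ(w)‖ ≤ r` for all `w`, and any weight level `j ≤ n`:
`(Lʲη)·η⁻¹·‖(∇_{U,μ}(GpKnitY η U Λ))(z)‖ ≤ (Σ‖b_j‖)·A₁·c·M₂·r`. [cite: Balaban1985RegularSpaces, (1.101) p.93, (1.1) p.76, p.86; Balaban1985BackgroundPropagators, Thm 3.1 (3.42) p.397, (3.3) p.390, (3.47) p.398] -/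
theorem wt_norm_cdS_GpKnitY_apply_le (hι : ∀ s, β i.hN i.D i.hk (ιB s) = s) {n : ℕ} (hlev : ∀ z : SiteY i, levY i z = n)
    (hcf : i.cf = (((ℓ + 1 : ℕ) : ℝ)) ^ i.k) (U : CfgY (Matrix (Fin N) (Fin N) ℂ) i) (μ : Fin (d + 1)) {A₁ δ c : ℝ} (hA₁ : 0 ≤ A₁)
    (hD : HasMajorant (g := toB6 (geo9K i) Rr Hp) (fun p : SiteY i × ι => ιB (blkOf i.D.toDomains p.1))
      (conj b (diffLetter (shiftY i) (UboxY i U) ((((etaS i : ℝ) : ℂ))⁻¹) (Sum.inl μ)) * conj b ((etaS i ^ 2) • (GpY i (parKnitY i) U).restrictScalars ℝ))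
      (fun a a' => A₁ * (geo9K i).len a * Real.exp (-(δ * (geo9K i).dist a a'))))
    (hrow : ∀ a : (geo9K i).Site, ∑ a' : (geo9K i).Site, Real.exp (-(δ * (geo9K i).dist a a')) ≤ c)
    {M₂ : ℝ} (hM₂ : 0 ≤ M₂) (hrepr : ∀ (v : Matrix (Fin N) (Fin N) ℂ) (j : ι), |b.repr v j| ≤ M₂ * ‖v‖)
    {η : ℝ} (hη : 0 < η) (Λ : SiteY i → Matrix (Fin N) (Fin N) ℂ) {r : ℝ} (hΛ : ∀ w, ((((ℓ + 1 : ℕ) : ℝ)) ^ n * η) ^ 2 * ‖Λ w‖ ≤ r)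
    {j : ℕ} (hj : j ≤ n) (z : SiteY i) :
    ((((ℓ + 1 : ℕ) : ℝ)) ^ j * η) * (η⁻¹ * ‖cdS i U μ (GpKnitY i η U Λ) z‖) ≤ (∑ j, ‖b j‖) * A₁ * c * M₂ * r := by
  have hL1 : (1 : ℝ) ≤ ((ℓ + 1 : ℕ) : ℝ) := by exact_mod_cast Nat.succ_le_succ (Nat.zero_le ℓ)
  have hLn : (0 : ℝ) < (((ℓ + 1 : ℕ) : ℝ)) ^ n := by positivity
  have hw : 0 < ((((ℓ + 1 : ℕ) : ℝ)) ^ n * η) ^ 2 := by positivity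
  have hΛ' : ∀ w, ‖Λ w‖ ≤ r / ((((ℓ + 1 : ℕ) : ℝ)) ^ n * η) ^ 2 := fun w => by rw [le_div_iff₀ hw, mul_comm]; exact hΛ w
  have hr : 0 ≤ r := le_trans (by positivity) (hΛ z)
  have h := norm_cdS_GpY_parKnitY_apply_le i b ιB hι hlev hcf U μ hA₁ hD hrow hM₂ hrepr Λ hΛ' z
  have hSb : 0 ≤ ∑ j, ‖b j‖ := Finset.sum_nonneg fun _ _ => norm_nonneg _
  have hC : 0 ≤ (∑ j, ‖b j‖) * A₁ * c * M₂ := by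
    have hc : 0 ≤ c := le_trans (Finset.sum_nonneg fun _ _ => (Real.exp_pos _).le) (hrow (ιB (blkOf i.D.toDomains z)))
    positivity
  -- `∇_μ(η²G′Λ) = η²∇_μ(G′Λ)`
  have hsm : cdS i U μ (GpKnitY i η U Λ) z = (((η * η : ℝ)) : ℂ) • cdS i U μ (GpY i (parKnitY i) U Λ) z := by
    have : GpKnitY i η U Λ = (((η * η : ℝ)) : ℂ) • GpY i (parKnitY i) U Λ := GpKnitY_apply i η U Λ
    rw [this, cdS_smul, Pi.smul_apply]
  rw [hsm, norm_smul, Complex.norm_real, Real.norm_of_nonneg (mul_self_nonneg η)]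
  have hjn : (((ℓ + 1 : ℕ) : ℝ)) ^ j ≤ (((ℓ + 1 : ℕ) : ℝ)) ^ n := pow_le_pow_right₀ hL1 hj
  calc (((ℓ + 1 : ℕ) : ℝ)) ^ j * η * (η⁻¹ * (η * η * ‖cdS i U μ (GpY i (parKnitY i) U Λ) z‖))
      = (((ℓ + 1 : ℕ) : ℝ)) ^ j * (η * η) * ‖cdS i U μ (GpY i (parKnitY i) U Λ) z‖ := by field_simp
    _ ≤ (((ℓ + 1 : ℕ) : ℝ)) ^ n * (η * η) * ((∑ j, ‖b j‖) * A₁ * c * M₂ * (((ℓ + 1 : ℕ) : ℝ)) ^ n * (r / ((((ℓ + 1 : ℕ) : ℝ)) ^ n * η) ^ 2)) := by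
        refine mul_le_mul (mul_le_mul_of_nonneg_right hjn (mul_self_nonneg η)) h (norm_nonneg _) (by positivity)
    _ = (∑ j, ‖b j‖) * A₁ * c * M₂ * r := by field_simp

/-- ★ **… READ ON THE KNIT's `ℤ^{d+1}` CARRIER** (J-A `covDerivFwd_liftY`: `D^η_{U₀,μ}(f♯)(x) = η⁻¹(∇_{U,μ}Φ)(chart x)` for `U₀ = liftCfg U`, `f♯ = liftFun(Φ ∘ chart)`):
`(Lʲη)·‖D^η_{U₀,μ}(liftFun((GpKnitY η U Λ) ∘ chart))(x)‖ ≤ (Σ‖b_j‖)·A₁·c·M₂·r` for every `x ∈ ℤ^{d+1}`, `j ≤ n`.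
[cite: Balaban1985RegularSpaces, (1.101) p.93, (1.1) p.76, p.77 («Ω_j = T_η»); Balaban1985BackgroundPropagators, (3.3) p.390, Thm 3.1 (3.42) p.397] -/
theorem wt_norm_covDerivFwd_liftFun_le (hι : ∀ s, β i.hN i.D i.hk (ιB s) = s) {n : ℕ} (hlev : ∀ z : SiteY i, levY i z = n)
    (hcf : i.cf = (((ℓ + 1 : ℕ) : ℝ)) ^ i.k) (U : CfgY (Matrix (Fin N) (Fin N) ℂ) i) (μ : Fin (d + 1)) {A₁ δ c : ℝ} (hA₁ : 0 ≤ A₁)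
    (hD : HasMajorant (g := toB6 (geo9K i) Rr Hp) (fun p : SiteY i × ι => ιB (blkOf i.D.toDomains p.1))
      (conj b (diffLetter (shiftY i) (UboxY i U) ((((etaS i : ℝ) : ℂ))⁻¹) (Sum.inl μ)) * conj b ((etaS i ^ 2) • (GpY i (parKnitY i) U).restrictScalars ℝ))
      (fun a a' => A₁ * (geo9K i).len a * Real.exp (-(δ * (geo9K i).dist a a'))))
    (hrow : ∀ a : (geo9K i).Site, ∑ a' : (geo9K i).Site, Real.exp (-(δ * (geo9K i).dist a a')) ≤ c)
    {M₂ : ℝ} (hM₂ : 0 ≤ M₂) (hrepr : ∀ (v : Matrix (Fin N) (Fin N) ℂ) (j : ι), |b.repr v j| ≤ M₂ * ‖v‖)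
    {η : ℝ} (hη : 0 < η) (Λ : SiteY i → Matrix (Fin N) (Fin N) ℂ) {r : ℝ} (hΛ : ∀ w, ((((ℓ + 1 : ℕ) : ℝ)) ^ n * η) ^ 2 * ‖Λ w‖ ≤ r)
    {j : ℕ} (hj : j ≤ n) (x : B7Prop1Explicit.Site (d + 1)) :
    ((((ℓ + 1 : ℕ) : ℝ)) ^ j * η) * ‖covDerivFwd η (liftCfg U) μ (liftFun ((GpKnitY i η U Λ) ∘ ⇑(boxEquiv i.hN))) x‖ ≤ (∑ j, ‖b j‖) * A₁ * c * M₂ * r := by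
  rw [covDerivFwd_liftY, norm_smul, Real.norm_of_nonneg (inv_nonneg.2 hη.le)]
  exact wt_norm_cdS_GpKnitY_apply_le i b ιB hι hlev hcf U μ hA₁ hD hrow hM₂ hrepr hη Λ hΛ hj _

end Knit

end Literature.MathematicalPhysics.QuantumFieldTheory.Balaban1983to89.B9B8KnitLetterE12Sup

end
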